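import Summits.AtomisticToContinuum.HydrodynamicLimit.Theorems.LambertianContactSwapLambertianEulerSecondMoment
import HarnessLib

/-!
# The mixed second moment of the Lambert cosine law

Crux `Summit.AtomisticToContinuum.HydrodynamicLimit.Theses.LambertianContactSwap.ContactAngleEquidistribution`
(stmt-AtomisticToContinuum-12097), line `Sketch`, stub `stub_lambertMixedMoment_unit` (section `KappaMean`:
the cosine-law mean of the collisional change of a quadratic velocity observable).

For a unit contact normal `ω` of `ℝ³` and a standard Gaussian vector `ξ`, the Lambertian direction
`n = lambertDir ω ξ` has the second-moment matrix `E[n ⊗ n] = ¼ (1 + ω ⊗ ω)`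
(`…LambertianEulerSecondMoment.secondMoment_unit`: `E[⟪c, n⟫²] = ¼ (‖c‖² + ⟪c, ω⟫²)`). This file records
its POLARISATION

`E[⟪a, n⟫ ⟪c, n⟫] = ¼ (⟪a, c⟫ + ⟪a, ω⟫ ⟪c, ω⟫)` (`stub_lambertMixedMoment_unit`):

pointwise `⟪a, n⟫ ⟪c, n⟫ = ¼ (⟪a + c, n⟫² − ⟪a − c, n⟫²)` (`mixedMoment_polarise`), hence
`E[⟪a, n⟫ ⟪c, n⟫] = ¼ (Q(a + c) − Q(a − c))` with `Q(c) = E[⟪c, n⟫²]` (`mixedMoment_eq_sub`, the two squares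
are integrable by `integrable_inner_lambertDir_sq`), and `Q(a ± c) = ¼ (‖a ± c‖² + ⟪a ± c, ω⟫²)` expand by
`norm_add_sq_real`, `norm_sub_sq_real`.

References: folklore (C. Cercignani, R. Illner, M. Pulvirenti, *The Mathematical Theory of Dilute Gases*
(1994), App. 4.A, for the cosine law of the contact normal).
-/

noncomputable section

open MeasureTheory ProbabilityTheory
open scoped RealInnerProductSpace

namespace Summit.AtomisticToContinuum.HydrodynamicLimit.Theorems.ContactAngleEquidistributionSketch

open Literature.MathematicalPhysics.KineticTheory
open Summit.AtomisticToContinuum.HydrodynamicLimit.Theorems.LambertianContactSwapLambertianEulerSecondMoment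

/-- Pointwise polarisation: `⟪a, n⟫ ⟪c, n⟫ = ¼ (⟪a + c, n⟫² − ⟪a − c, n⟫²)`. [folklore] -/
theorem mixedMoment_polarise (a c n : V3) :
    ⟪a, n⟫ * ⟪c, n⟫ = 4⁻¹ * (⟪a + c, n⟫ ^ 2 - ⟪a - c, n⟫ ^ 2) := by
  rw [inner_add_left, inner_sub_left]
  ring

/-- Polarisation of the quadratic form `Q(c) = E[⟪c, lambertDir ω ξ⟫²]`:
`E[⟪a, n⟫ ⟪c, n⟫] = ¼ (Q(a + c) − Q(a − c))` (both squares are integrable,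
`integrable_inner_lambertDir_sq`). [folklore] -/
theorem mixedMoment_eq_sub (ω a c : V3) :
    ∫ ξ, ⟪a, lambertDir ω ξ⟫ * ⟪c, lambertDir ω ξ⟫ ∂(stdGaussian V3) =
      4⁻¹ * (∫ ξ, ⟪a + c, lambertDir ω ξ⟫ ^ 2 ∂(stdGaussian V3) -
        ∫ ξ, ⟪a - c, lambertDir ω ξ⟫ ^ 2 ∂(stdGaussian V3)) := by
  rw [← integral_sub (integrable_inner_lambertDir_sq ω _) (integrable_inner_lambertDir_sq ω _),
    ← integral_const_mul]
  refine integral_congr_ae (Filter.Eventually.of_forall fun ξ => ?_)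
  exact mixedMoment_polarise a c _

/-- **Mixed second moment of the Lambert cosine law, unit normal** (stub `stub_lambertMixedMoment_unit`,
line `Sketch`, crux stmt-AtomisticToContinuum-12097): for `‖ω‖ = 1`, a standard Gaussian `ξ` of `ℝ³`
and all `a, c ∈ ℝ³`, `E[⟪a, lambertDir ω ξ⟫ ⟪c, lambertDir ω ξ⟫] = ¼ (⟪a, c⟫ + ⟪a, ω⟫ ⟪c, ω⟫)` — the
polarisation of `secondMoment_unit` (`E[⟪c, n⟫²] = ¼ (‖c‖² + ⟪c, ω⟫²)`): `¼ (Q(a + c) − Q(a − c))`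
expanded with `norm_add_sq_real`, `norm_sub_sq_real`. [folklore] -/
theorem stub_lambertMixedMoment_unit {ω : V3} (hω : ‖ω‖ = 1) (a c : V3) :
    ∫ ξ, ⟪a, lambertDir ω ξ⟫ * ⟪c, lambertDir ω ξ⟫ ∂(stdGaussian V3) = 4⁻¹ * (⟪a, c⟫ + ⟪a, ω⟫ * ⟪c, ω⟫) := by
  rw [mixedMoment_eq_sub, secondMoment_unit hω, secondMoment_unit hω, norm_add_sq_real,
    norm_sub_sq_real, inner_add_left, inner_sub_left]
  ring

end Summit.AtomisticToContinuum.HydrodynamicLimit.Theorems.ContactAngleEquidistributionSketch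

end
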